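import Mathlib
import Summits.Ventures.PercRepro2.A3CutFibres

/-!
# The fibre sums of the cut vertex scale on `A`-side events
(blind cell PercRepro2, night-1 g32; proofs/NIGHT1-G32.md §5; the fibres of a vertex behind the cut are
A3CutBehind.lean, the expansion is A3CutExpand.lean)

Setting of A3CutFibres: `x` a cut vertex, the marks `o, a₁, a₂, b` on the `B`-side.
* `mZ`, `SsigZ`, `SuZ` — the fibre masses of the `x`-exploration restricted to an event `Z`; on the pair
  `W = S ∪ T` (`S ⊆ VA`, `x ∈ T ⊆ VB ∪ {x}`) and an `A`-side `Z` they factor as `aZ S · (B-side mass of T)`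
  (`mZ_pair`, `SsigZ_pair`, `SuZ_pair`).
* **`sum_fibre_x_scale`**: every fibre sum of a term `T` that is `1`-homogeneous in the masses, vanishes at
  `0` and sees `W` only through its `B`-part (`s3`, the `A`-condition) scales by `P(Z)` when the fibres are
  restricted to an `A`-side event `Z` (`sum_fibre_x_restricted`: both are the `A`-side probability times
  the `B`-side fibre sum).
Standard axioms.
-/

namespace Summit.Ventures.PercRepro2

open UnionCluster CovForm CutV

namespace CovForm

namespace A3Fibre

/-! ## Restricted fibre masses and side masses -/

section Defs

variable {V : Type*} {E : Type*} [Fintype V] [DecidableEq V] [Fintype E] [DecidableEq E]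
  {R : Type*} [CommRing R]

/-- The fibre mass of the `x`-exploration restricted to `Z`. -/
noncomputable def mZ (p : E → R) (ends : E → Sym2 V) (a₁ a₂ x : V) (Z : Set (Config E))
    (W : Finset V) : R :=
  prob p (fibre ends a₁ a₂ x W ∩ Z)

/-- The `σ_y`-mass of the `x`-exploration restricted to `Z`. -/
noncomputable def SsigZ (p : E → R) (ends : E → Sym2 V) (a₁ a₂ x y : V) (Z : Set (Config E))
    (W : Finset V) : R :=
  prob p (fibre ends a₁ a₂ x W ∩ Z ∩ connEvent ends a₁ y) -
    prob p (fibre ends a₁ a₂ x W ∩ Z ∩ connEvent ends a₂ y)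

/-- The `U_y`-mass of the `x`-exploration restricted to `Z`. -/
noncomputable def SuZ (p : E → R) (ends : E → Sym2 V) (a₁ a₂ x y : V) (Z : Set (Config E))
    (W : Finset V) : R :=
  prob p (fibre ends a₁ a₂ x W ∩ Z ∩ connEvent ends a₁ y) +
    prob p (fibre ends a₁ a₂ x W ∩ Z ∩ connEvent ends a₂ y)

omit [Fintype V] [DecidableEq V] in
/-- Unrestricted: `mZ` at `Z = univ` is `m_W`. -/
lemma mZ_univ (p : E → R) (ends : E → Sym2 V) (a₁ a₂ x : V) (W : Finset V) :
    mZ p ends a₁ a₂ x Set.univ W = mW p ends a₁ a₂ x W := by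
  simp [mZ, mW]

omit [Fintype V] [DecidableEq V] in
/-- Unrestricted: `SsigZ` at `Z = univ` is `Ssig`. -/
lemma SsigZ_univ (p : E → R) (ends : E → Sym2 V) (a₁ a₂ x y : V) (W : Finset V) :
    SsigZ p ends a₁ a₂ x y Set.univ W = Ssig p ends a₁ a₂ x y W := by
  simp [SsigZ, Ssig]

omit [Fintype V] [DecidableEq V] in
/-- Unrestricted: `SuZ` at `Z = univ` is `Su`. -/
lemma SuZ_univ (p : E → R) (ends : E → Sym2 V) (a₁ a₂ x y : V) (W : Finset V) :
    SuZ p ends a₁ a₂ x y Set.univ W = Su p ends a₁ a₂ x y W := by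
  simp [SuZ, Su]

end Defs

/-! ## The factorisation of the restricted masses on a pair -/

section Pairs

variable {V : Type*} {E : Type*} [Fintype V] [DecidableEq V] [Fintype E] [DecidableEq E]
  {R : Type*} [CommRing R] {ends : E → Sym2 V} {x : V} {VA VB : Finset V} {EA EB : Set E}
  [DecidablePred (· ∈ EA)] [DecidablePred (· ∈ EB)] {p : E → R}

omit [Fintype V] [Fintype E] [DecidableEq E] [CommRing R] [DecidablePred (· ∈ EA)] in
/-- A vertex of `VB ∪ {x}` as a set member of `↑VB ∪ {x}`. -/
lemma mem_coe_union_of_mem_insert {u : V} (hu : u ∈ insert x VB) : u ∈ (↑VB : Set V) ∪ {x} := by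
  rcases Finset.mem_insert.1 hu with rfl | hu
  · exact Or.inr rfl
  · exact Or.inl (Finset.mem_coe.2 hu)

omit [Fintype V] [Fintype E] [DecidableEq E] [CommRing R] [DecidablePred (· ∈ EA)] in
/-- `Q` is a `B`-side event when both roots are in `VB ∪ {x}`. -/
lemma avoidAll_eq_sideEventB' (h : IsCut ends x ↑VA ↑VB EA EB) {a₁ a₂ : V} (h1 : a₁ ∈ insert x VB)
    (h2 : a₂ ∈ insert x VB) : avoidAll ends a₂ {a₁} = sideEvent EB (avoidAll ends a₂ {a₁}) := by
  ext ω
  simp only [mem_sideEvent, mem_avoidAll, Finset.mem_singleton, forall_eq]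
  exact not_congr (conn_iff_restrict h.symm (mem_coe_union_of_mem_insert h2)
    (mem_coe_union_of_mem_insert h1))

omit [Fintype V] [Fintype E] [DecidableEq E] [CommRing R] [DecidablePred (· ∈ EA)] in
/-- A connection event between vertices of `VB ∪ {x}` is a `B`-side event. -/
lemma connEvent_eq_sideEventB' (h : IsCut ends x ↑VA ↑VB EA EB) {u w : V} (hu : u ∈ insert x VB)
    (hw : w ∈ insert x VB) : connEvent ends u w = sideEvent EB (connEvent ends u w) :=
  connEvent_eq_sideEvent h.symm (mem_coe_union_of_mem_insert hu) (mem_coe_union_of_mem_insert hw)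

omit [Fintype V] in
/-- `mZ` on a pair factors. -/
lemma mZ_pair (h : IsCut ends x ↑VA ↑VB EA EB) {a₁ a₂ : V} (h1 : a₁ ∈ insert x VB) (h2 : a₂ ∈ insert x VB)
    (Z' : Set (Config E)) {S : Finset V} (hS : S ⊆ VA) {T : Finset V} (hT : T ⊆ insert x VB)
    (hxT : x ∈ T) :
    mZ p ends a₁ a₂ x (sideEvent EA Z') (S ∪ T) =
      prob p (sideEvent EA (clusterEvent ends x (↑(insert x S) : Set V) ∩ Z')) *
        prob p (sideEvent EB (clusterEvent ends x (↑T : Set V) ∩ avoidAll ends a₂ {a₁})) := by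
  unfold mZ fibre
  have e : avoidAll ends a₂ {a₁} ∩ clusterEvent ends x (↑(S ∪ T) : Set V) ∩ sideEvent EA Z' =
      clusterEvent ends x (↑(S ∪ T) : Set V) ∩ sideEvent EA Z' ∩ sideEvent EB (avoidAll ends a₂ {a₁}) := by
    rw [← avoidAll_eq_sideEventB' h h1 h2]
    ext ω; simp only [Set.mem_inter_iff]; tauto
  rw [e, prob_clusterEvent_x_inter_eq_mul p h hS hT hxT]

omit [Fintype V] in
/-- A restricted fibre–connection mass on a pair factors. -/
lemma prob_fibre_Z_conn_pair (h : IsCut ends x ↑VA ↑VB EA EB) {a₁ a₂ : V} (h1 : a₁ ∈ insert x VB)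
    (h2 : a₂ ∈ insert x VB) (Z' : Set (Config E)) {S : Finset V} (hS : S ⊆ VA) {T : Finset V}
    (hT : T ⊆ insert x VB) (hxT : x ∈ T) {r y : V} (hr : r ∈ insert x VB) (hy : y ∈ insert x VB) :
    prob p (fibre ends a₁ a₂ x (S ∪ T) ∩ sideEvent EA Z' ∩ connEvent ends r y) =
      prob p (sideEvent EA (clusterEvent ends x (↑(insert x S) : Set V) ∩ Z')) *
        prob p (sideEvent EB (clusterEvent ends x (↑T : Set V) ∩
          (avoidAll ends a₂ {a₁} ∩ connEvent ends r y))) := by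
  unfold fibre
  have e : avoidAll ends a₂ {a₁} ∩ clusterEvent ends x (↑(S ∪ T) : Set V) ∩ sideEvent EA Z' ∩
      connEvent ends r y =
      clusterEvent ends x (↑(S ∪ T) : Set V) ∩ sideEvent EA Z' ∩
        sideEvent EB (avoidAll ends a₂ {a₁} ∩ connEvent ends r y) := by
    rw [← sideEvent_inter, ← avoidAll_eq_sideEventB' h h1 h2, ← connEvent_eq_sideEventB' h hr hy]
    ext ω; simp only [Set.mem_inter_iff]; tauto
  rw [e, prob_clusterEvent_x_inter_eq_mul p h hS hT hxT]

omit [Fintype V] in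
/-- `SsigZ` on a pair factors. -/
lemma SsigZ_pair (h : IsCut ends x ↑VA ↑VB EA EB) {a₁ a₂ : V} (h1 : a₁ ∈ insert x VB) (h2 : a₂ ∈ insert x VB)
    (Z' : Set (Config E)) {S : Finset V} (hS : S ⊆ VA) {T : Finset V} (hT : T ⊆ insert x VB)
    (hxT : x ∈ T) {y : V} (hy : y ∈ insert x VB) :
    SsigZ p ends a₁ a₂ x y (sideEvent EA Z') (S ∪ T) =
      prob p (sideEvent EA (clusterEvent ends x (↑(insert x S) : Set V) ∩ Z')) *
        (prob p (sideEvent EB (clusterEvent ends x (↑T : Set V) ∩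
            (avoidAll ends a₂ {a₁} ∩ connEvent ends a₁ y))) -
          prob p (sideEvent EB (clusterEvent ends x (↑T : Set V) ∩
            (avoidAll ends a₂ {a₁} ∩ connEvent ends a₂ y)))) := by
  unfold SsigZ
  rw [prob_fibre_Z_conn_pair h h1 h2 Z' hS hT hxT h1 hy, prob_fibre_Z_conn_pair h h1 h2 Z' hS hT hxT h2 hy]
  ring

omit [Fintype V] in
/-- `SuZ` on a pair factors. -/
lemma SuZ_pair (h : IsCut ends x ↑VA ↑VB EA EB) {a₁ a₂ : V} (h1 : a₁ ∈ insert x VB) (h2 : a₂ ∈ insert x VB)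
    (Z' : Set (Config E)) {S : Finset V} (hS : S ⊆ VA) {T : Finset V} (hT : T ⊆ insert x VB)
    (hxT : x ∈ T) {y : V} (hy : y ∈ insert x VB) :
    SuZ p ends a₁ a₂ x y (sideEvent EA Z') (S ∪ T) =
      prob p (sideEvent EA (clusterEvent ends x (↑(insert x S) : Set V) ∩ Z')) *
        (prob p (sideEvent EB (clusterEvent ends x (↑T : Set V) ∩
            (avoidAll ends a₂ {a₁} ∩ connEvent ends a₁ y))) +
          prob p (sideEvent EB (clusterEvent ends x (↑T : Set V) ∩
            (avoidAll ends a₂ {a₁} ∩ connEvent ends a₂ y)))) := by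
  unfold SuZ
  rw [prob_fibre_Z_conn_pair h h1 h2 Z' hS hT hxT h1 hy, prob_fibre_Z_conn_pair h h1 h2 Z' hS hT hxT h2 hy]
  ring

omit [Fintype V] [DecidableEq V] [DecidablePred (· ∈ EA)] [DecidablePred (· ∈ EB)] in
/-- The restricted masses vanish on an empty fibre. -/
lemma mZ_eq_zero_of_empty {a₁ a₂ : V} (Z : Set (Config E)) {W : Finset V}
    (hW : clusterEvent ends x (↑W : Set V) = ∅) : mZ p ends a₁ a₂ x Z W = 0 := by
  unfold mZ fibre
  rw [hW]
  simp

omit [Fintype V] [DecidableEq V] [DecidablePred (· ∈ EA)] [DecidablePred (· ∈ EB)] in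
/-- The restricted masses vanish on an empty fibre. -/
lemma SsigZ_eq_zero_of_empty {a₁ a₂ y : V} (Z : Set (Config E)) {W : Finset V}
    (hW : clusterEvent ends x (↑W : Set V) = ∅) : SsigZ p ends a₁ a₂ x y Z W = 0 := by
  unfold SsigZ fibre
  rw [hW]
  simp

omit [Fintype V] [DecidableEq V] [DecidablePred (· ∈ EA)] [DecidablePred (· ∈ EB)] in
/-- The restricted masses vanish on an empty fibre. -/
lemma SuZ_eq_zero_of_empty {a₁ a₂ y : V} (Z : Set (Config E)) {W : Finset V}
    (hW : clusterEvent ends x (↑W : Set V) = ∅) : SuZ p ends a₁ a₂ x y Z W = 0 := by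
  unfold SuZ fibre
  rw [hW]
  simp

end Pairs

/-! ## The fibre sums of the cut vertex scale on `A`-side events -/

section Scale

variable {V : Type*} {E : Type*} [Fintype V] [DecidableEq V] [Fintype E] [DecidableEq E]
  {R : Type*} [CommRing R] {ends : E → Sym2 V} {x : V} {VA VB : Finset V} {EA EB : Set E}
  [DecidablePred (· ∈ EA)] [DecidablePred (· ∈ EB)] {p : E → R}

omit [Fintype V] [Fintype E] [DecidableEq E] [DecidablePred (· ∈ EA)] [DecidablePred (· ∈ EB)] in
/-- `VA` and `VB ∪ {x}` are disjoint. -/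
lemma disjoint_VA_insert (h : IsCut ends x ↑VA ↑VB EA EB) : Disjoint VA (insert x VB) := by
  rw [Finset.disjoint_insert_right]
  exact ⟨fun hx => h.x_notA (Finset.mem_coe.2 hx), Finset.disjoint_coe.1 h.disj⟩

/-- **The generic fibre sum of the cut vertex restricted to an `A`-side event** equals the `A`-side
probability times the `B`-side fibre sum. -/
lemma sum_fibre_x_restricted (h : IsCut ends x ↑VA ↑VB EA EB) {o a₁ a₂ b : V} (ho : o ∈ insert x VB)
    (h1 : a₁ ∈ insert x VB) (h2 : a₂ ∈ insert x VB) (hb : b ∈ insert x VB) (Z' : Set (Config E))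
    (T : Finset V → R → R → R → R → R → R) (hT0 : ∀ W, T W 0 0 0 0 0 = 0)
    (hThom : ∀ W c m sb so ub uo, T W (c * m) (c * sb) (c * so) (c * ub) (c * uo) =
      c * T W m sb so ub uo)
    (hTB : ∀ S, S ⊆ VA → ∀ W, T (S ∪ W) = T W) :
    ∑ W, T W (mZ p ends a₁ a₂ x (sideEvent EA Z') W) (SsigZ p ends a₁ a₂ x b (sideEvent EA Z') W)
        (SsigZ p ends a₁ a₂ x o (sideEvent EA Z') W) (SuZ p ends a₁ a₂ x b (sideEvent EA Z') W)
        (SuZ p ends a₁ a₂ x o (sideEvent EA Z') W) =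
      prob p (sideEvent EA Z') *
        ∑ W ∈ (insert x VB).powerset, T W
          (prob p (sideEvent EB (clusterEvent ends x (↑W : Set V) ∩ avoidAll ends a₂ {a₁})))
          (prob p (sideEvent EB (clusterEvent ends x (↑W : Set V) ∩
              (avoidAll ends a₂ {a₁} ∩ connEvent ends a₁ b))) -
            prob p (sideEvent EB (clusterEvent ends x (↑W : Set V) ∩
              (avoidAll ends a₂ {a₁} ∩ connEvent ends a₂ b))))
          (prob p (sideEvent EB (clusterEvent ends x (↑W : Set V) ∩
              (avoidAll ends a₂ {a₁} ∩ connEvent ends a₁ o))) -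
            prob p (sideEvent EB (clusterEvent ends x (↑W : Set V) ∩
              (avoidAll ends a₂ {a₁} ∩ connEvent ends a₂ o))))
          (prob p (sideEvent EB (clusterEvent ends x (↑W : Set V) ∩
              (avoidAll ends a₂ {a₁} ∩ connEvent ends a₁ b))) +
            prob p (sideEvent EB (clusterEvent ends x (↑W : Set V) ∩
              (avoidAll ends a₂ {a₁} ∩ connEvent ends a₂ b))))
          (prob p (sideEvent EB (clusterEvent ends x (↑W : Set V) ∩
              (avoidAll ends a₂ {a₁} ∩ connEvent ends a₁ o))) +
            prob p (sideEvent EB (clusterEvent ends x (↑W : Set V) ∩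
              (avoidAll ends a₂ {a₁} ∩ connEvent ends a₂ o)))) := by
  rw [sum_eq_sum_pairs VA (insert x VB) (disjoint_VA_insert h) _ ?_]
  · rw [← sum_prob_sideA_cluster_inter p h Z', Finset.sum_mul]
    refine Finset.sum_congr rfl fun S hS => ?_
    rw [Finset.mem_powerset] at hS
    rw [Finset.mul_sum]
    refine Finset.sum_congr rfl fun W hW => ?_
    rw [Finset.mem_powerset] at hW
    by_cases hxW : x ∈ W
    · rw [mZ_pair h h1 h2 Z' hS hW hxW, SsigZ_pair h h1 h2 Z' hS hW hxW hb,
        SsigZ_pair h h1 h2 Z' hS hW hxW ho, SuZ_pair h h1 h2 Z' hS hW hxW hb,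
        SuZ_pair h h1 h2 Z' hS hW hxW ho, hThom, hTB S hS]
    · have he : clusterEvent ends x (↑(S ∪ W) : Set V) = ∅ :=
        clusterEvent_x_eq_empty_of_notMem (fun hx => hxW (by
          rcases Finset.mem_union.1 hx with hx | hx
          · exact absurd (Finset.mem_coe.2 (hS hx)) h.x_notA
          · exact hx))
      rw [mZ_eq_zero_of_empty _ he, SsigZ_eq_zero_of_empty _ he, SsigZ_eq_zero_of_empty _ he,
        SuZ_eq_zero_of_empty _ he, SuZ_eq_zero_of_empty _ he, hT0]
      have he' : clusterEvent ends x (↑W : Set V) = ∅ := clusterEvent_x_eq_empty_of_notMem hxW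
      have hz : ∀ Y : Set (Config E), prob p (sideEvent EB (clusterEvent ends x (↑W : Set V) ∩ Y)) = 0 := by
        intro Y
        rw [he', Set.empty_inter]
        have : sideEvent EB (∅ : Set (Config E)) = ∅ := by ext ω; simp [mem_sideEvent]
        rw [this, prob_empty]
      simp only [hz, sub_self, add_zero, hT0, mul_zero]
  · intro W hW
    have he : clusterEvent ends x (↑W : Set V) = ∅ := clusterEvent_x_eq_empty_of_not_subset h hW
    rw [mZ_eq_zero_of_empty _ he, SsigZ_eq_zero_of_empty _ he, SsigZ_eq_zero_of_empty _ he,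
      SuZ_eq_zero_of_empty _ he, SuZ_eq_zero_of_empty _ he, hT0]

/-- **Scaling**: the generic fibre sum of the cut vertex restricted to an `A`-side event `Z` is `P(Z)`
times the unrestricted sum. -/
theorem sum_fibre_x_scale (h : IsCut ends x ↑VA ↑VB EA EB) {o a₁ a₂ b : V} (ho : o ∈ insert x VB)
    (h1 : a₁ ∈ insert x VB) (h2 : a₂ ∈ insert x VB) (hb : b ∈ insert x VB) (Z' : Set (Config E))
    (T : Finset V → R → R → R → R → R → R) (hT0 : ∀ W, T W 0 0 0 0 0 = 0)
    (hThom : ∀ W c m sb so ub uo, T W (c * m) (c * sb) (c * so) (c * ub) (c * uo) =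
      c * T W m sb so ub uo)
    (hTB : ∀ S, S ⊆ VA → ∀ W, T (S ∪ W) = T W) :
    ∑ W, T W (mZ p ends a₁ a₂ x (sideEvent EA Z') W) (SsigZ p ends a₁ a₂ x b (sideEvent EA Z') W)
        (SsigZ p ends a₁ a₂ x o (sideEvent EA Z') W) (SuZ p ends a₁ a₂ x b (sideEvent EA Z') W)
        (SuZ p ends a₁ a₂ x o (sideEvent EA Z') W) =
      prob p (sideEvent EA Z') *
        ∑ W, T W (mW p ends a₁ a₂ x W) (Ssig p ends a₁ a₂ x b W) (Ssig p ends a₁ a₂ x o W)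
          (Su p ends a₁ a₂ x b W) (Su p ends a₁ a₂ x o W) := by
  have huniv : (Set.univ : Set (Config E)) = sideEvent EA Set.univ := by
    ext ω; simp [mem_sideEvent]
  have h2' := sum_fibre_x_restricted (p := p) h ho h1 h2 hb Set.univ T hT0 hThom hTB
  rw [← huniv, prob_univ, one_mul] at h2'
  simp only [mZ_univ, SsigZ_univ, SuZ_univ] at h2'
  rw [h2', sum_fibre_x_restricted h ho h1 h2 hb Z' T hT0 hThom hTB]

end Scale

end A3Fibre

end CovForm

end Summit.Ventures.PercRepro2
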